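import Mathlib
import Summits.MatrixMultiplication.MatrixMultiplication.Theses.HiddenToeplitzCorners

/-!
# Hankel matrices: two coprime kernel polynomials force a zero symbol (Sylvester)

Negative-side tool for crux `HiddenCorners` (stmt-MatrixMultiplication-7492), line `ApolarSketch`, stub
`stub_honest` (honest Hankel corners): lemma (F1) of `Cruxes/HiddenCorners/HonestHankelNoGo.md`.

Let `h : ℕ → ℂ` be a symbol and `H = [h (i + j)]_{i,j < N}` its `N × N` Hankel matrix.  A vector
`c : Fin N → ℂ` is identified with the polynomial `P_c = Σ c_i X^i`.  If `c` and `c'` are both kernel vectors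
of `H` (`Σ_i c_i h (i + j) = 0` for all `j < N`), the polynomials `P_c, P_{c'}` are coprime, and one of them has
full degree `N - 1`, then `h k = 0` for all `k < 2N - 1` (so `H = 0`).  Equivalently: a nonzero Hankel matrix
never has two kernel vectors whose degree-`(N-1)` binary forms are coprime.  Proof: the functional
`L(p) = Σ_{k < 2N-1} h_k p_k` kills `u · P_c` and `u' · P_{c'}` whenever `deg u, deg u' ≤ N - 1`, and by Bézout
plus division with remainder by the full-degree polynomial every `X^k`, `k ≤ 2N - 2`, is of that form.
[classical: Sylvester 1840; Heinig–Rost, *Algebraic methods for Toeplitz-like matrices and operators* (1984),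
ch. 5; Iarrobino–Kanev, LNM 1721, Lemma 1.31]
-/

set_option linter.dupNamespace false

namespace Summit.MatrixMultiplication.MatrixMultiplication.Cruxes.HiddenCorners.ApolarSketch

open scoped BigOperators Polynomial
open Polynomial

section HankelCoprime

/-- The coefficients of the kernel polynomial `Σ_{i<N} c_i X^i`. -/
private theorem coeff_kerPoly (N : ℕ) (c : Fin N → ℂ) (m : ℕ) :
    (∑ i : Fin N, C (c i) * X ^ (i : ℕ)).coeff m = if hm : m < N then c ⟨m, hm⟩ else 0 := by
  rw [finsetSum_coeff]
  simp only [coeff_C_mul, coeff_X_pow]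
  split_ifs with hm
  · rw [Finset.sum_eq_single ⟨m, hm⟩]
    · simp
    · intro i _ hi
      have : m ≠ (i : ℕ) := fun h => hi (Fin.ext h.symm)
      simp [this]
    · intro h; exact absurd (Finset.mem_univ _) h
  · refine Finset.sum_eq_zero fun i _ => ?_
    have : m ≠ (i : ℕ) := fun h => hm (h ▸ i.isLt)
    simp [this]

/-- The symbol functional kills `X^j · P_c` for a kernel vector `c` and `j < N`:
`Σ_k h_k (X^j P_c)_k = Σ_i c_i h_{i+j}`. -/
private theorem functional_X_pow_mul (N : ℕ) (h : ℕ → ℂ) (c : Fin N → ℂ) (j : Fin N) :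
    ∑ k ∈ Finset.range (2 * N - 1), h k * (X ^ (j : ℕ) * ∑ i : Fin N, C (c i) * X ^ (i : ℕ)).coeff k =
      ∑ i : Fin N, c i * h ((i : ℕ) + (j : ℕ)) := by
  have hj := j.isLt
  -- split the range at `j` and shift
  have hsplit : Finset.range (2 * N - 1) = Finset.range (j : ℕ) ∪ Finset.Ico (j : ℕ) (2 * N - 1) := by
    rw [Finset.range_eq_Ico, Finset.range_eq_Ico,
      Finset.Ico_union_Ico_eq_Ico (Nat.zero_le _) (by omega : (j : ℕ) ≤ 2 * N - 1)]
  rw [hsplit, Finset.sum_union (Finset.disjoint_left.mpr fun x hx hx' => by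
      simp only [Finset.mem_range] at hx; simp only [Finset.mem_Ico] at hx'; omega)]
  have hzero : ∑ k ∈ Finset.range (j : ℕ),
      h k * (X ^ (j : ℕ) * ∑ i : Fin N, C (c i) * X ^ (i : ℕ)).coeff k = 0 := by
    refine Finset.sum_eq_zero fun k hk => ?_
    rw [Finset.mem_range] at hk
    rw [coeff_X_pow_mul', if_neg (by omega), mul_zero]
  rw [hzero, zero_add, Finset.sum_Ico_eq_sum_range]
  simp only [coeff_X_pow_mul', le_add_iff_nonneg_right, zero_le, if_true, add_tsub_cancel_left,
    coeff_kerPoly]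
  -- now the sum over `i < 2N - 1 - j` of `h (j + i) * (if i < N then c i else 0)`
  have hN : N ≤ 2 * N - 1 - (j : ℕ) := by omega
  rw [← Finset.sum_range_add_sum_Ico _ hN]
  have hzero2 : ∑ i ∈ Finset.Ico N (2 * N - 1 - (j : ℕ)),
      h ((j : ℕ) + i) * (if hm : i < N then c ⟨i, hm⟩ else 0) = 0 := by
    refine Finset.sum_eq_zero fun i hi => ?_
    rw [Finset.mem_Ico] at hi
    rw [dif_neg (by omega), mul_zero]
  rw [hzero2, add_zero, ← Fin.sum_univ_eq_sum_range (fun i => h ((j : ℕ) + i) *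
    (if hm : i < N then c ⟨i, hm⟩ else 0)) N]
  refine Finset.sum_congr rfl fun i _ => ?_
  rw [dif_pos i.isLt, mul_comm, add_comm]

/-- The symbol functional kills `u · P_c` for every `u` of degree `< N` when `c` is a kernel vector. -/
private theorem functional_mul_eq_zero (N : ℕ) (h : ℕ → ℂ) (c : Fin N → ℂ)
    (hc : ∀ j : Fin N, ∑ i : Fin N, c i * h ((i : ℕ) + (j : ℕ)) = 0)
    (u : ℂ[X]) (hu : u.natDegree < N) :
    ∑ k ∈ Finset.range (2 * N - 1), h k * (u * ∑ i : Fin N, C (c i) * X ^ (i : ℕ)).coeff k = 0 := by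
  set P : ℂ[X] := ∑ i : Fin N, C (c i) * X ^ (i : ℕ) with hP
  clear_value P
  have hu' : u = ∑ j ∈ Finset.range N, C (u.coeff j) * X ^ j := by
    simpa only [C_mul_X_pow_eq_monomial] using as_sum_range' u N hu
  have hdist : ∀ k, h k * (u * P).coeff k =
      ∑ j ∈ Finset.range N, h k * (C (u.coeff j) * X ^ j * P).coeff k := by
    intro k
    conv_lhs => rw [hu']
    rw [Finset.sum_mul, finsetSum_coeff, Finset.mul_sum]
  rw [Finset.sum_congr rfl fun k _ => hdist k, Finset.sum_comm]
  refine Finset.sum_eq_zero fun j hj => ?_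
  rw [Finset.mem_range] at hj
  have key := functional_X_pow_mul N h c ⟨j, hj⟩
  simp only at key
  calc ∑ k ∈ Finset.range (2 * N - 1), h k * (C (u.coeff j) * X ^ j * P).coeff k
      = u.coeff j * ∑ k ∈ Finset.range (2 * N - 1), h k * (X ^ j * P).coeff k := by
        rw [Finset.mul_sum]
        refine Finset.sum_congr rfl fun k _ => ?_
        rw [mul_assoc, coeff_C_mul]
        ring
    _ = 0 := by rw [hP, key, hc ⟨j, hj⟩, mul_zero]

/-- Core: Bézout plus division with remainder by the full-degree kernel polynomial. -/
private theorem hankel_coprime_kernel_aux (N : ℕ) (h : ℕ → ℂ) (c c' : Fin N → ℂ)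
    (hc : ∀ j : Fin N, ∑ i : Fin N, c i * h ((i : ℕ) + (j : ℕ)) = 0)
    (hc' : ∀ j : Fin N, ∑ i : Fin N, c' i * h ((i : ℕ) + (j : ℕ)) = 0)
    (hcop : IsCoprime (∑ i : Fin N, C (c i) * X ^ (i : ℕ)) (∑ i : Fin N, C (c' i) * X ^ (i : ℕ)))
    (hfull : (∑ i : Fin N, C (c' i) * X ^ (i : ℕ)).natDegree = N - 1)
    (hne' : (∑ i : Fin N, C (c' i) * X ^ (i : ℕ)) ≠ 0)
    (k : ℕ) (hk : k < 2 * N - 1) : h k = 0 := by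
  set P : ℂ[X] := ∑ i : Fin N, C (c i) * X ^ (i : ℕ) with hP
  set Q : ℂ[X] := ∑ i : Fin N, C (c' i) * X ^ (i : ℕ) with hQ
  clear_value P Q
  have hN : 1 ≤ N := by omega
  have hPdeg : P.natDegree ≤ N - 1 := by
    rw [hP]
    refine natDegree_sum_le_of_forall_le _ _ fun i _ => ?_
    refine (natDegree_C_mul_X_pow_le _ _).trans ?_
    have := i.isLt
    omega
  obtain ⟨a, b, hab⟩ := hcop
  -- `X^k * a = Q * q + u`, `deg u < deg Q = N - 1`
  set p : ℂ[X] := X ^ k with hp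
  set q : ℂ[X] := (p * a) / Q with hq
  set u : ℂ[X] := (p * a) % Q with hu
  have hdivmod : Q * q + u = p * a := EuclideanDomain.div_add_mod _ _
  have hudeg : u.natDegree < N := by
    have h1 : u.degree < Q.degree := EuclideanDomain.mod_lt _ hne'
    rcases eq_or_ne u 0 with h0 | h0
    · rw [h0, natDegree_zero]; omega
    · have := natDegree_lt_natDegree h0 h1
      omega
  set u' : ℂ[X] := p * b + q * P with hu'
  have hdecomp : u * P + u' * Q = p := by
    have : u = p * a - Q * q := by rw [← hdivmod]; ring
    rw [this, hu']
    linear_combination p * hab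
  have hu'deg : u'.natDegree < N := by
    rcases eq_or_ne u' 0 with h0 | h0
    · rw [h0, natDegree_zero]; omega
    · have hmul : (u' * Q).natDegree = u'.natDegree + Q.natDegree := natDegree_mul h0 hne'
      have heq : u' * Q = p - u * P := by rw [← hdecomp]; ring
      have hbound : (p - u * P).natDegree ≤ 2 * N - 2 := by
        refine (natDegree_sub_le _ _).trans (max_le ?_ ?_)
        · rw [hp, natDegree_X_pow]; omega
        · refine natDegree_mul_le.trans ?_
          omega
      rw [← heq, hmul, hfull] at hbound
      omega
  -- apply the functional
  have hL : ∑ m ∈ Finset.range (2 * N - 1), h m * p.coeff m = h k := by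
    rw [hp, Finset.sum_eq_single k]
    · simp
    · intro m _ hm; simp [coeff_X_pow, hm]
    · intro hk'; exact absurd (Finset.mem_range.mpr hk) hk'
  rw [← hL, ← hdecomp]
  simp only [coeff_add, mul_add, Finset.sum_add_distrib]
  subst hP hQ
  rw [functional_mul_eq_zero N h c hc u hudeg, functional_mul_eq_zero N h c' hc' u' hu'deg, add_zero]

/-- **Sylvester for Hankel kernels (F1).**  If `c, c'` are kernel vectors of the `N × N` Hankel matrix
`[h (i + j)]`, their polynomials `Σ c_i X^i`, `Σ c'_i X^i` are coprime, and one of the top coefficients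
`c_{N-1}, c'_{N-1}` is nonzero (so that the two degree-`(N-1)` binary forms are coprime), then all symbols
`h k`, `k < 2N - 1`, vanish. -/
theorem hankel_coprime_kernel (N : ℕ) (h : ℕ → ℂ) (c c' : Fin N → ℂ)
    (hc : ∀ j : Fin N, ∑ i : Fin N, c i * h ((i : ℕ) + (j : ℕ)) = 0)
    (hc' : ∀ j : Fin N, ∑ i : Fin N, c' i * h ((i : ℕ) + (j : ℕ)) = 0)
    (hcop : IsCoprime (∑ i : Fin N, Polynomial.C (c i) * Polynomial.X ^ (i : ℕ))
      (∑ i : Fin N, Polynomial.C (c' i) * Polynomial.X ^ (i : ℕ)))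
    (htop : ∃ i : Fin N, (i : ℕ) = N - 1 ∧ (c i ≠ 0 ∨ c' i ≠ 0)) :
    ∀ k, k < 2 * N - 1 → h k = 0 := by
  intro k hk
  obtain ⟨i₀, hi₀, htop⟩ := htop
  -- the polynomial with nonzero top coefficient has full degree `N - 1` and is nonzero
  have full : ∀ d : Fin N → ℂ, d i₀ ≠ 0 →
      (∑ i : Fin N, C (d i) * X ^ (i : ℕ)).natDegree = N - 1 ∧
        (∑ i : Fin N, C (d i) * X ^ (i : ℕ)) ≠ 0 := by
    intro d hd
    have hcoeff : (∑ i : Fin N, C (d i) * X ^ (i : ℕ)).coeff (N - 1) = d i₀ := by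
      rw [coeff_kerPoly, dif_pos (by omega)]
      congr 1
      exact Fin.ext hi₀.symm
    have hne : (∑ i : Fin N, C (d i) * X ^ (i : ℕ)) ≠ 0 := by
      intro h0; rw [h0, coeff_zero] at hcoeff; exact hd hcoeff.symm
    refine ⟨le_antisymm ?_ ?_, hne⟩
    · refine natDegree_sum_le_of_forall_le _ _ fun i _ => ?_
      refine (natDegree_C_mul_X_pow_le _ _).trans ?_
      have := i.isLt
      omega
    · exact le_natDegree_of_ne_zero (by rw [hcoeff]; exact hd)
  rcases htop with h1 | h2
  · obtain ⟨hfull, hne⟩ := full c h1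
    exact hankel_coprime_kernel_aux N h c' c hc' hc hcop.symm hfull hne k hk
  · obtain ⟨hfull, hne⟩ := full c' h2
    exact hankel_coprime_kernel_aux N h c c' hc hc' hcop hfull hne k hk

end HankelCoprime

end Summit.MatrixMultiplication.MatrixMultiplication.Cruxes.HiddenCorners.ApolarSketch
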